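import Literature.AlgebraicGeometry.ComplexMultiplication.CyclotomicFermatCMTypesProductsOfEllipticCurves
import Literature.AlgebraicGeometry.ComplexMultiplication.CyclotomicFermatCMTypesFixedFieldOfStabilizer
import HarnessLib

/-!
# Bauer–Coste–Itzykson–Ruelle §3.4 at the level `24`: the sixteen CM types of `ℚ(ζ₂₄)` — ONE isogeny class of simple fourfolds
# (the class of `H_{1,3,20} = {1,5,11,17}`) and FOUR classes `E⁴`, `E` an elliptic curve with complex multiplication by
# `ℚ(√−6)`, `ℚ(i)`, `ℚ(√−3)`, `ℚ(√−2)` read off the residue stabiliser `W`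

Layer `Literature/AlgebraicGeometry/ComplexMultiplication`; sequel of `CyclotomicFermatCMTypesProductsOfEllipticCurves` (this lane gen 41:
«`F_n` is isogenous to a product of elliptic curves iff `n ≤ 12` divides `24`» on the Koblitz–Rohrlich factor types; at `n = 24`:
`H_{1,3,20} = {1,5,11,17}` is not a group, `W_{1,3,20} = {1}`, its realisations are SIMPLE FOURFOLDS), of
`CyclotomicFermatCMTypesFixedFieldOfStabilizer` (the field `K₁` of the simple factor is the fixed field of `{σ_w | w ∈ W}`) and of
`CyclotomicFermatCMTypesEllipticFactorsCMFields` (gen 41, levels `8` and `12`: `W ∈ {{1,3},{1,5}}` resp. `{{1,5},{1,7}}`, the fields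
`ℚ(√−2)`, `ℚ(i)`, `ℚ(ω)`, and at `24` only the COUNT `157 + 4·24` of the admissible triples by their `H`; honest column (c): «that the
`96` give 24 copies of one fourfold … is not assembled; the CM fields of the `157` elliptic curves at `24` are not listed»).  THIS FILE does
the level `24 = 2³·3` — the largest level dividing `24`, `φ(24) = 8`, `(ℤ/24)ˣ ≅ (ℤ/2)³` — COMPLETELY for every CM type of `ℚ(ζ₂₄)`, on
abelian varieties.  THEOREMS ONLY (no definition, no named fact, no `sorry`; kernel `decide` over the SIXTEEN sign vectors
`e : Fin 4 → Bool` parametrising the CM residue sets `{±1, ±5, ±7, ±11}` modulo `24`).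

THE SOURCE.  M. Bauer, A. Coste, C. Itzykson, P. Ruelle, *Comments on the links between su(3) modular invariants, simple factors in the
Jacobian of Fermat curves, and rational triangular billiards*, J. Geom. Phys. **22** (1997) 134–189, §3.4 (held `paper:arxiv-hep-th_9604104`
pp. 14–15, read first-hand): «Being a subset of `ℤ₂₄*`, `H_{r,s,t}` is automatically a group because every element of `ℤ₂₄*` has a square
equal to 1 modulo 24 (24 is the largest integer to have this property). On the other hand, for `n = 24`, `H_{r,s,t}` can be of order 4 and
it is no longer guaranteed to be a group. An explicit calculation shows that indeed it is not always a group … Finally for `n = 24`, there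
are 24 triplets `(r,s,t)` such that their `H_{r,s,t}` is not a group, for instance `H_{1,3,20} = {1,5,11,17}`. The corresponding `L_{r,s,t}`
are all equal and their product is `[L_{1,3,20}]^{24}`, with `L_{1,3,20} ⊂ ℂ⁴` simple because `W_{1,3,20} = {1}`. Putting everything together,
one obtains … `F_{24} ∼ [ℂ⁴/L_{1,3,20}]^{24} ⊕ [product of 157 elliptic curves]`»; and §3.3 p. 13–14 (the general mechanism, after
Koblitz–Rohrlich p. 1184 and Shimura–Taniyama): «if `W(P_+) ≠ {1}`, `A` is isogenous to the product of `|W(P_+)|` isomorphic simple factors,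
each one having complex multiplication by the subfield of `F` fixed by `W(P_+)`», «two factors … will be isogenous if and only if they have
the same CM-type up to a Galois automorphism, i.e. `H_{r,s,t} = H_{xr',xs',xt'}` for some `x`».

READING (as in the siblings).  A CM type `Φ` of `L = ℚ(ζ₂₄)` is read on exponents as its CM residue set `S = S_Φ ⊂ (ℤ/24)ˣ`
(`CyclotomicCMTypeResidueSets`); `W = W(S) = {t ∈ (ℤ/24)ˣ | ∀ c ∈ (ℤ/24)ˣ, ct ∈ S ⟺ c ∈ S}` is the residue stabiliser (the
`Finset.filter` expression, spelled out); «`K`» is the field `K₁` of ANY primitive sub-pair `(K₁, Φ₁)` inducing `Φ` — the field of complex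
multiplication of the simple factor (gen 14 `exists_isIsogeny_power_simple_cyclotomic`: `A ∼ B^{|W|}`, `B` simple, `2 dim B · |W| = φ(N)`,
`[ℚ(ζ_N) : K₁] = |W|`).  The «explicit calculation» is the kernel's: every CM residue set modulo `24` is `{ε₁·1, ε₅·5, ε₇·7, ε₁₁·11}` for a
sign vector `ε` (`exists_signs_of_isCMResidueSet_twentyFour`), and over the sixteen sign vectors `decide` computes `W`.

## What is proved

* §0 (any level `N`): `eq_stabilizerResidues_of_one_mem_of_two_mul_card_eq` (`1 ∈ S` and `2|W| = φ(N)` ⟹ `S = W`: «`W ⊂ H` implies `W = H`»);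
  private `eq_adjoin_of_mem_of_sq_eq_neg` (a quadratic subfield containing `δ` with `δ² = −m < 0` is `ℚ(δ)`; copy of the gen-41 helper).
* §1 THE RESIDUE SETS MODULO `24`: `unitResidues_twentyFour` (`(ℤ/24)ˣ = {1,5,7,11,13,17,19,23}`), **`forall_unit_mul_self_twentyFour`** («every
  element of `ℤ₂₄*` has a square equal to 1»), **`exists_signs_of_isCMResidueSet_twentyFour`** (every CM residue set is
  `{±1, ±5, ±7, ±11}` for a sign vector — sixteen CM types), `isCMResidueSet_signs_twentyFour` (each of the sixteen is one),
  **`stabilizerResidues_eq_or_twentyFour`** — «the explicit calculation»: for EVERY CM residue set `S` modulo `24`,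
  `W(S) ∈ {{1}, {1,5,7,11}, {1,5,13,17}, {1,7,13,19}, {1,11,17,19}}` —, **`card_stabilizerResidues_eq_one_or_four_twentyFour`** (`|W| ∈ {1, 4}`:
  NO CM type of `ℚ(ζ₂₄)` has exactly two simple factors), **`stabilizerResidues_eq_singleton_iff_exists_translate_twentyFour`** (`W(S) = {1}`
  iff `S` is a unit translate of `H_{1,3,20} = {1,5,11,17}`: the eight sets with trivial stabiliser form ONE orbit under `(ℤ/24)ˣ`),
  `eq_or_eq_neg_of_card_stabilizerResidues_eq_four_twentyFour` (`|W| = 4` ⟹ `S = W` or `S = −W`), and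
  **`exists_translate_iff_stabilizerResidues_eq_twentyFour`** (two CM residue sets modulo `24` are unit translates of each other iff they
  have the SAME stabiliser: five translation classes, labelled by `W`).
* §2 `ℚ(ζ₂₄)` (any model `L`): `zetaOf_pow_twelve_twentyFour` (`ζ¹² = −1`), **`zetaOf_pow_eight_sub_pow_four_add_one_twentyFour`**
  (`Φ₂₄(ζ) = ζ⁸ − ζ⁴ + 1 = 0`), the four square roots **`sq_gaussPeriod_twentyFour`** (`(ζ + ζ⁵ + ζ⁷ + ζ¹¹)² = −6` — the Gauss period of
  `{1,5,7,11}`), `sq_zetaOf_pow_three_add_pow_nine_twentyFour` (`(ζ³ + ζ⁹)² = −2`), `sq_zetaOf_pow_six_twentyFour` (`(ζ⁶)² = −1`),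
  `sq_one_add_two_zetaOf_pow_eight_twentyFour` (`(1 + 2ζ⁸)² = −3`, `ζ⁸ = ω`, `omega_relation_twentyFour`); the fixed elements
  `apply_gaussPeriod_twentyFour` (`σ_h` fixes `ζ + ζ⁵ + ζ⁷ + ζ¹¹` for `h ∈ {5,7,11}`), `apply_zetaOf_pow_six_twentyFour` (`h ∈ {5,13,17}`),
  `apply_zetaOf_pow_eight_twentyFour` (`h ∈ {7,13,19}`), `apply_zetaOf_pow_three_add_pow_nine_twentyFour` (`h ∈ {11,17,19}`), and
  `apply_zetaOf_pow_three_add_pow_nine_of_autResidue_eq_five` (`σ₅(ζ³ + ζ⁹) = −(ζ³ + ζ⁹)`: `√−2` is MOVED by `σ₅`); for every CM type `Φ` of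
  `ℚ(ζ₂₄)` and ANY primitive sub-pair `(K₁, Φ₁)`: `finrank_eq_two_of_card_eq_four_twentyFour` (`|W| = 4` ⟹ `[K₁ : ℚ] = 2`) and THE FOUR FIXED
  FIELDS **`eq_adjoin_gaussPeriod_of_stabilizerResidues_eq`** (`W = {1,5,7,11}` ⟹ `K₁ = ℚ(ζ + ζ⁵ + ζ⁷ + ζ¹¹)`, `(·)² = −6`),
  **`eq_adjoin_zetaOf_pow_six_of_stabilizerResidues_eq`** (`W = {1,5,13,17}` ⟹ `K₁ = ℚ(ζ⁶)`, `(·)² = −1`),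
  **`eq_adjoin_one_add_two_zetaOf_pow_eight_of_stabilizerResidues_eq`** (`W = {1,7,13,19}` ⟹ `K₁ = ℚ(1 + 2ζ⁸) ∋ ζ⁸ = ω`, `(·)² = −3`),
  **`eq_adjoin_zetaOf_pow_three_add_pow_nine_of_stabilizerResidues_eq`** (`W = {1,11,17,19}` ⟹ `K₁ = ℚ(ζ³ + ζ⁹)`, `(·)² = −2`), and
  `zetaOf_pow_three_add_pow_nine_notMem_of_stabilizerResidues_eq` (`W = {1,5,7,11}` ⟹ `ζ³ + ζ⁹ ∉ K₁`: that field is NOT `ℚ(√−2)`).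
* §3 ON ABELIAN VARIETIES (every CM type `Φ` of `ℚ(ζ₂₄)`, every realisation `A`): `dim_eq_four_twentyFour`; **`isSimple_or_card_eq_four_twentyFour`**;
  **`exists_isIsogeny_pow_four_elliptic_of_card_eq_four_twentyFour`** (`|W| = 4`: `A` is `𝓞_{K₁}`-equivariantly isogenous to `E × E × E × E`, `E`
  an ELLIPTIC CURVE with complex multiplication `𝓞_{K₁} → End E`, `[K₁ : ℚ] = 2`); the four field-labelled forms
  **`exists_isIsogeny_pow_four_elliptic_sqrt_neg_six ∕ _sqrt_neg_one ∕ _sqrt_neg_three ∕ _sqrt_neg_two`** (`W = {1,5,7,11}`: `K₁ = ℚ(δ)`,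
  `δ² = −6`; `{1,5,13,17}`: `−1`; `{1,7,13,19}`: `−3`; `{1,11,17,19}`: `−2`); the DICHOTOMY **`isSimple_or_exists_isIsogeny_pow_four_elliptic_twentyFour`**
  (every abelian variety with complex multiplication by `ℚ(ζ₂₄)` is a simple fourfold or `∼ E⁴` with `E` elliptic, CM by `𝓞_{ℚ(δ)}`,
  `δ² ∈ {−1, −2, −3, −6}`); and THE ISOGENY CLASSES **`isIsogenous_iff_stabilizerResidues_eq_twentyFour`** (two abelian varieties with complex
  multiplication by `ℚ(ζ₂₄)` are isogenous iff their types have the same residue stabiliser — FIVE isogeny classes), in particular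
  **`isIsogenous_of_isSimple_twentyFour`** («the corresponding `L_{r,s,t}` are all equal»: ANY two simple abelian varieties with complex
  multiplication by `ℚ(ζ₂₄)` are isogenous — one isogeny class of simple CM fourfolds with this field, that of `H_{1,3,20}`).

## Honest column

(a) «24 is the largest integer to have this property» (every unit squares to `1` iff `N ∣ 24`) is not typed here (only the level `24` and, in
the sibling, `8` and `12`); the Koblitz–Rohrlich triples at `24` (which `H_τ` occur, BCIR's counts, «`[L_{1,3,20}]^{24}`») are the sequel file's.
(b) «`ℚ(√−6)`, `ℚ(i)`, `ℚ(√−3)`, `ℚ(√−2)`» are typed as the explicit subfields `ℚ(δ) ⊂ ℚ(ζ₂₄)`, `δ ∈ {ζ+ζ⁵+ζ⁷+ζ¹¹, ζ⁶, 1+2ζ⁸, ζ³+ζ⁹}`,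
`δ² = −6, −1, −3, −2`, `[ℚ(δ) : ℚ] = 2`; rings of integers are not computed and `E` is determined up to isogeny only.  (c) The field
`ℚ(√−6)` does not occur at any level `n ≤ 12` and is not named by BCIR, whose p. 15 remark «namely `ℚ(√−2)` for `n = 8` and `24`» is examined
in the sequel (the identity-block triples of `E₂₄` have `H = {1,5,7,11}`, field `ℚ(√−6)`).  The Hodge conjecture is not proved and nothing
here bears on it.
-/

noncomputable section

open NumberField

namespace Literature.AlgebraicGeometry.ComplexMultiplication

open CategoryTheory CategoryTheory.Limits
open Literature.AlgebraicGeometry.Motives (CMType AbelianVariety)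
open Literature.AlgebraicGeometry.Motives.AbelianVariety
open Literature.NumberTheory.ComplexMultiplication
open Literature.AlgebraicGeometry.HodgeTheory
open Literature.AlgebraicGeometry.Pohlmann1968 Literature.AlgebraicGeometry.Pohlmann1968.Cyclotomic
open CyclotomicCMTypeResidueSets (IsCMResidueSet unitResidues residueSet residueSet_cmTypeOfResidues isCMResidueSet_residueSet
  autResidue autResidue_spec exists_autResidue_eq two_mul_card_eq_card_unitResidues card_unitResidues)

/-! ## §0 Helpers at any level -/

section General

variable {N : ℕ} [NeZero N]

/-- **«`W ⊂ H` implies `W = H`»**: a CM residue set containing `1` whose stabiliser has `2|W| = φ(N)` IS its stabiliser (`W = 1·W ⊆ S` and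
`|S| = φ(N)/2 = |W|`). [cite: BauerCosteItzyksonRuelle1997, §3.4] -/
theorem eq_stabilizerResidues_of_one_mem_of_two_mul_card_eq {S : Finset (ZMod N)} (hS : IsCMResidueSet N S) (h1 : (1 : ZMod N) ∈ S)
    (hW : 2 * ((unitResidues N).filter fun t => ∀ c ∈ unitResidues N, (c * t ∈ S ↔ c ∈ S)).card = N.totient) :
    S = (unitResidues N).filter fun t => ∀ c ∈ unitResidues N, (c * t ∈ S ↔ c ∈ S) := by
  have hsub : ((unitResidues N).filter fun t => ∀ c ∈ unitResidues N, (c * t ∈ S ↔ c ∈ S)) ⊆ S := fun t ht => by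
    simpa using mul_mem_of_mem_stabilizerResidues hS h1 ht
  have hcard : S.card ≤ ((unitResidues N).filter fun t => ∀ c ∈ unitResidues N, (c * t ∈ S ↔ c ∈ S)).card := by
    have hS2 := two_mul_card_eq_card_unitResidues hS
    rw [card_unitResidues] at hS2
    omega
  exact (Finset.eq_of_subset_of_card_le hsub hcard).symm

variable {L : Type} [Field L] [NumberField L]

/-- A quadratic subfield containing a square root `δ` of a negative integer is `ℚ(δ)` (`ℚ(δ) ≠ ℚ` as `δ² < 0`, and `[ℚ(δ) : ℚ]` divides
`[K₁ : ℚ] = 2`). [folklore] -/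
private theorem eq_adjoin_of_mem_of_sq_eq_neg {K₁ : IntermediateField ℚ L} {δ : L} (hδ : δ ∈ K₁) {m : ℕ} (hm : 0 < m)
    (hsq : δ ^ 2 = -(m : L)) (hdeg : Module.finrank ℚ K₁ = 2) : K₁ = IntermediateField.adjoin ℚ {δ} := by
  have hle : IntermediateField.adjoin ℚ {δ} ≤ K₁ := IntermediateField.adjoin_simple_le_iff.2 hδ
  have hne : Module.finrank ℚ (IntermediateField.adjoin ℚ {δ}) ≠ 1 := by
    intro h1
    rw [IntermediateField.finrank_eq_one_iff, IntermediateField.adjoin_simple_eq_bot_iff, IntermediateField.mem_bot] at h1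
    obtain ⟨q, hq⟩ := h1
    have hq2 : (algebraMap ℚ L) (q ^ 2) = (algebraMap ℚ L) (-(m : ℚ)) := by
      rw [map_pow, hq, hsq, map_neg, map_natCast]
    have hq2' : q ^ 2 = -(m : ℚ) := (algebraMap ℚ L).injective hq2
    have hm' : (0 : ℚ) < m := by exact_mod_cast hm
    nlinarith [sq_nonneg q]
  haveI : FiniteDimensional ℚ K₁ := inferInstance
  have hdvd : Module.finrank ℚ (IntermediateField.adjoin ℚ {δ}) ∣ 2 := hdeg ▸ IntermediateField.finrank_dvd_of_le_right hle
  have h2 : Module.finrank ℚ (IntermediateField.adjoin ℚ {δ}) = 2 := by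
    rcases (Nat.dvd_prime Nat.prime_two).1 hdvd with h | h
    · exact absurd h hne
    · exact h
  exact (IntermediateField.eq_of_le_of_finrank_eq hle (h2.trans hdeg.symm)).symm

end General

/-! ## §1 The residue sets modulo `24`: sixteen CM types, stabilisers `{1}` (eight of them, one orbit) or a group of order `4` (eight, `±H`) -/

section Residues

/-- `(ℤ/24)ˣ = {1, 5, 7, 11, 13, 17, 19, 23}` (the exponents of `Gal(ℚ(ζ₂₄)/ℚ)`). [cite: Washington1997, Thm. 2.5] -/
theorem unitResidues_twentyFour : unitResidues 24 = {1, 5, 7, 11, 13, 17, 19, 23} := by decide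

/-- **«Every element of `ℤ₂₄*` has a square equal to `1` modulo `24`»** (kernel check). [cite: BauerCosteItzyksonRuelle1997, §3.4] -/
theorem forall_unit_mul_self_twentyFour : ∀ u ∈ unitResidues 24, u * u = 1 := by decide

/-- Every unit modulo `24` is `±1, ±5, ±7` or `±11`. [folklore] -/
private theorem exists_eq_rep_or_eq_neg_twentyFour :
    ∀ t ∈ unitResidues 24, ∃ i : Fin 4, t = (![1, 5, 7, 11] : Fin 4 → ZMod 24) i ∨ t = -(![1, 5, 7, 11] : Fin 4 → ZMod 24) i := by
  decide

/-- The representatives `1, 5, 7, 11` and their negatives are units. [folklore] -/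
private theorem rep_mem_unitResidues_twentyFour (i : Fin 4) :
    (![1, 5, 7, 11] : Fin 4 → ZMod 24) i ∈ unitResidues 24 ∧ -(![1, 5, 7, 11] : Fin 4 → ZMod 24) i ∈ unitResidues 24 := by
  revert i; decide

/-- **THE SIXTEEN CM TYPES OF `ℚ(ζ₂₄)` AS SIGN VECTORS.**  Every CM residue set `S ⊂ (ℤ/24)ˣ` (one of `c, −c` for every unit `c`) is
`{ε₁·1, ε₅·5, ε₇·7, ε₁₁·11}` for the sign vector `εᵣ = +` iff `r ∈ S` (Shimura's «`2ⁿ` CM types» of a CM field of degree `2n`, `n = 4`).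
[cite: Shimura1998, §8.4 Example (1)] [cite: BauerCosteItzyksonRuelle1997, §3.4] -/
theorem exists_signs_of_isCMResidueSet_twentyFour {S : Finset (ZMod 24)} (hS : IsCMResidueSet 24 S) :
    ∃ e : Fin 4 → Bool, S = Finset.univ.image fun i : Fin 4 =>
      if e i then (![1, 5, 7, 11] : Fin 4 → ZMod 24) i else -(![1, 5, 7, 11] : Fin 4 → ZMod 24) i := by
  refine ⟨fun i => decide ((![1, 5, 7, 11] : Fin 4 → ZMod 24) i ∈ S), ?_⟩
  ext t
  simp only [Finset.mem_image, Finset.mem_univ, true_and, decide_eq_true_eq]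
  constructor
  · intro ht
    obtain ⟨i, hi | hi⟩ := exists_eq_rep_or_eq_neg_twentyFour t (hS.1 ht)
    · refine ⟨i, ?_⟩
      subst hi
      simp [ht]
    · refine ⟨i, ?_⟩
      have hnot : (![1, 5, 7, 11] : Fin 4 → ZMod 24) i ∉ S := by
        intro hmem
        have := (hS.2 _ (rep_mem_unitResidues_twentyFour i).1).1 hmem
        exact this (hi ▸ ht)
      simp [hnot, hi]
  · rintro ⟨i, hi⟩
    by_cases he : (![1, 5, 7, 11] : Fin 4 → ZMod 24) i ∈ S
    · simp only [he, if_true] at hi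
      exact hi ▸ he
    · simp only [he, if_false] at hi
      subst hi
      have h := hS.2 _ (rep_mem_unitResidues_twentyFour i).2
      rw [neg_neg] at h
      exact h.2 he

/-- Conversely each of the sixteen sign sets IS a CM residue set modulo `24` (so there are exactly sixteen). [cite: Shimura1998, §8.4 Example (1)] -/
theorem isCMResidueSet_signs_twentyFour : ∀ e : Fin 4 → Bool, IsCMResidueSet 24 (Finset.univ.image fun i : Fin 4 =>
      if e i then (![1, 5, 7, 11] : Fin 4 → ZMod 24) i else -(![1, 5, 7, 11] : Fin 4 → ZMod 24) i) := by
  decide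

/-- «The explicit calculation» over the sixteen sign vectors: the stabiliser is `{1}` or one of the four groups of order `4` avoiding `−1 = 23`.
[cite: BauerCosteItzyksonRuelle1997, §3.4] -/
private theorem forall_signs_stabilizerResidues_twentyFour : ∀ e : Fin 4 → Bool,
    ((unitResidues 24).filter fun t => ∀ c ∈ unitResidues 24,
        (c * t ∈ (Finset.univ.image fun i : Fin 4 =>
            if e i then (![1, 5, 7, 11] : Fin 4 → ZMod 24) i else -(![1, 5, 7, 11] : Fin 4 → ZMod 24) i) ↔
          c ∈ (Finset.univ.image fun i : Fin 4 =>
            if e i then (![1, 5, 7, 11] : Fin 4 → ZMod 24) i else -(![1, 5, 7, 11] : Fin 4 → ZMod 24) i))) = {1} ∨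
    ((unitResidues 24).filter fun t => ∀ c ∈ unitResidues 24,
        (c * t ∈ (Finset.univ.image fun i : Fin 4 =>
            if e i then (![1, 5, 7, 11] : Fin 4 → ZMod 24) i else -(![1, 5, 7, 11] : Fin 4 → ZMod 24) i) ↔
          c ∈ (Finset.univ.image fun i : Fin 4 =>
            if e i then (![1, 5, 7, 11] : Fin 4 → ZMod 24) i else -(![1, 5, 7, 11] : Fin 4 → ZMod 24) i))) = {1, 5, 7, 11} ∨
    ((unitResidues 24).filter fun t => ∀ c ∈ unitResidues 24,
        (c * t ∈ (Finset.univ.image fun i : Fin 4 =>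
            if e i then (![1, 5, 7, 11] : Fin 4 → ZMod 24) i else -(![1, 5, 7, 11] : Fin 4 → ZMod 24) i) ↔
          c ∈ (Finset.univ.image fun i : Fin 4 =>
            if e i then (![1, 5, 7, 11] : Fin 4 → ZMod 24) i else -(![1, 5, 7, 11] : Fin 4 → ZMod 24) i))) = {1, 5, 13, 17} ∨
    ((unitResidues 24).filter fun t => ∀ c ∈ unitResidues 24,
        (c * t ∈ (Finset.univ.image fun i : Fin 4 =>
            if e i then (![1, 5, 7, 11] : Fin 4 → ZMod 24) i else -(![1, 5, 7, 11] : Fin 4 → ZMod 24) i) ↔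
          c ∈ (Finset.univ.image fun i : Fin 4 =>
            if e i then (![1, 5, 7, 11] : Fin 4 → ZMod 24) i else -(![1, 5, 7, 11] : Fin 4 → ZMod 24) i))) = {1, 7, 13, 19} ∨
    ((unitResidues 24).filter fun t => ∀ c ∈ unitResidues 24,
        (c * t ∈ (Finset.univ.image fun i : Fin 4 =>
            if e i then (![1, 5, 7, 11] : Fin 4 → ZMod 24) i else -(![1, 5, 7, 11] : Fin 4 → ZMod 24) i) ↔
          c ∈ (Finset.univ.image fun i : Fin 4 =>
            if e i then (![1, 5, 7, 11] : Fin 4 → ZMod 24) i else -(![1, 5, 7, 11] : Fin 4 → ZMod 24) i))) = {1, 11, 17, 19} := by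
  decide

/-- **«AN EXPLICIT CALCULATION», FOR EVERY CM TYPE OF `ℚ(ζ₂₄)`**: the residue stabiliser `W(S)` of every CM residue set `S` modulo `24` is
`{1}` or one of the four subgroups of order `4` of `(ℤ/24)ˣ ≅ (ℤ/2)³` not containing `−1`: `{1,5,7,11}`, `{1,5,13,17}`, `{1,7,13,19}`,
`{1,11,17,19}`. [cite: BauerCosteItzyksonRuelle1997, §3.4] [cite: Shimura1998, §8.2 Prop. 26] -/
theorem stabilizerResidues_eq_or_twentyFour {S : Finset (ZMod 24)} (hS : IsCMResidueSet 24 S) :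
    ((unitResidues 24).filter fun t => ∀ c ∈ unitResidues 24, (c * t ∈ S ↔ c ∈ S)) = {1} ∨
    ((unitResidues 24).filter fun t => ∀ c ∈ unitResidues 24, (c * t ∈ S ↔ c ∈ S)) = {1, 5, 7, 11} ∨
    ((unitResidues 24).filter fun t => ∀ c ∈ unitResidues 24, (c * t ∈ S ↔ c ∈ S)) = {1, 5, 13, 17} ∨
    ((unitResidues 24).filter fun t => ∀ c ∈ unitResidues 24, (c * t ∈ S ↔ c ∈ S)) = {1, 7, 13, 19} ∨
    ((unitResidues 24).filter fun t => ∀ c ∈ unitResidues 24, (c * t ∈ S ↔ c ∈ S)) = {1, 11, 17, 19} := by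
  obtain ⟨e, rfl⟩ := exists_signs_of_isCMResidueSet_twentyFour hS
  exact forall_signs_stabilizerResidues_twentyFour e

/-- **`|W| ∈ {1, 4}` AT LEVEL `24`** — NO CM type of `ℚ(ζ₂₄)` has `|W| = 2` (every unit being an involution, a set of two `W`-cosets
`xW ⊔ yW` is stable under `xy ∉ W`): every abelian variety with complex multiplication by `ℚ(ζ₂₄)` is simple or a fourth power.
[cite: BauerCosteItzyksonRuelle1997, §3.4] -/
theorem card_stabilizerResidues_eq_one_or_four_twentyFour {S : Finset (ZMod 24)} (hS : IsCMResidueSet 24 S) :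
    ((unitResidues 24).filter fun t => ∀ c ∈ unitResidues 24, (c * t ∈ S ↔ c ∈ S)).card = 1 ∨
      ((unitResidues 24).filter fun t => ∀ c ∈ unitResidues 24, (c * t ∈ S ↔ c ∈ S)).card = 4 := by
  rcases stabilizerResidues_eq_or_twentyFour hS with h | h | h | h | h <;> rw [h] <;> decide

/-- Hence `|W| ≠ 2` at level `24`. [cite: BauerCosteItzyksonRuelle1997, §3.4] -/
theorem card_stabilizerResidues_ne_two_twentyFour {S : Finset (ZMod 24)} (hS : IsCMResidueSet 24 S) :
    ((unitResidues 24).filter fun t => ∀ c ∈ unitResidues 24, (c * t ∈ S ↔ c ∈ S)).card ≠ 2 := by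
  rcases card_stabilizerResidues_eq_one_or_four_twentyFour hS with h | h <;> rw [h] <;> decide

/-- Over the sign vectors: trivial stabiliser iff a unit translate of `{1,5,11,17}`. [cite: BauerCosteItzyksonRuelle1997, §3.4] -/
private theorem forall_signs_eq_singleton_iff_exists_translate_twentyFour : ∀ e : Fin 4 → Bool,
    ((unitResidues 24).filter fun t => ∀ c ∈ unitResidues 24,
        (c * t ∈ (Finset.univ.image fun i : Fin 4 =>
            if e i then (![1, 5, 7, 11] : Fin 4 → ZMod 24) i else -(![1, 5, 7, 11] : Fin 4 → ZMod 24) i) ↔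
          c ∈ (Finset.univ.image fun i : Fin 4 =>
            if e i then (![1, 5, 7, 11] : Fin 4 → ZMod 24) i else -(![1, 5, 7, 11] : Fin 4 → ZMod 24) i))) = {1} ↔
      ∃ u ∈ unitResidues 24, ∀ c ∈ unitResidues 24,
        (c ∈ (Finset.univ.image fun i : Fin 4 =>
            if e i then (![1, 5, 7, 11] : Fin 4 → ZMod 24) i else -(![1, 5, 7, 11] : Fin 4 → ZMod 24) i) ↔
          c * u ∈ ({1, 5, 11, 17} : Finset (ZMod 24))) := by
  decide

/-- **`W = {1}` ⟺ A UNIT TRANSLATE OF `H_{1,3,20} = {1,5,11,17}`**: the eight CM residue sets modulo `24` with trivial stabiliser form ONE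
orbit under `(ℤ/24)ˣ` — the class of «`L_{1,3,20} ⊂ ℂ⁴` simple because `W_{1,3,20} = {1}`».  [cite: BauerCosteItzyksonRuelle1997, §3.4]
[cite: Shimura1998, §8.4 Example (1)] -/
theorem stabilizerResidues_eq_singleton_iff_exists_translate_twentyFour {S : Finset (ZMod 24)} (hS : IsCMResidueSet 24 S) :
    ((unitResidues 24).filter fun t => ∀ c ∈ unitResidues 24, (c * t ∈ S ↔ c ∈ S)) = {1} ↔
      ∃ u ∈ unitResidues 24, ∀ c ∈ unitResidues 24, (c ∈ S ↔ c * u ∈ ({1, 5, 11, 17} : Finset (ZMod 24))) := by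
  obtain ⟨e, rfl⟩ := exists_signs_of_isCMResidueSet_twentyFour hS
  exact forall_signs_eq_singleton_iff_exists_translate_twentyFour e

/-- Over the sign vectors: `|W| = 4` ⟹ `S = ±W`. [cite: BauerCosteItzyksonRuelle1997, §3.4] -/
private theorem forall_signs_eq_or_eq_neg_of_card_eq_four_twentyFour : ∀ e : Fin 4 → Bool,
    ((unitResidues 24).filter fun t => ∀ c ∈ unitResidues 24,
        (c * t ∈ (Finset.univ.image fun i : Fin 4 =>
            if e i then (![1, 5, 7, 11] : Fin 4 → ZMod 24) i else -(![1, 5, 7, 11] : Fin 4 → ZMod 24) i) ↔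
          c ∈ (Finset.univ.image fun i : Fin 4 =>
            if e i then (![1, 5, 7, 11] : Fin 4 → ZMod 24) i else -(![1, 5, 7, 11] : Fin 4 → ZMod 24) i))).card = 4 →
      (Finset.univ.image fun i : Fin 4 =>
          if e i then (![1, 5, 7, 11] : Fin 4 → ZMod 24) i else -(![1, 5, 7, 11] : Fin 4 → ZMod 24) i) =
        ((unitResidues 24).filter fun t => ∀ c ∈ unitResidues 24,
          (c * t ∈ (Finset.univ.image fun i : Fin 4 =>
              if e i then (![1, 5, 7, 11] : Fin 4 → ZMod 24) i else -(![1, 5, 7, 11] : Fin 4 → ZMod 24) i) ↔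
            c ∈ (Finset.univ.image fun i : Fin 4 =>
              if e i then (![1, 5, 7, 11] : Fin 4 → ZMod 24) i else -(![1, 5, 7, 11] : Fin 4 → ZMod 24) i))) ∨
      (Finset.univ.image fun i : Fin 4 =>
          if e i then (![1, 5, 7, 11] : Fin 4 → ZMod 24) i else -(![1, 5, 7, 11] : Fin 4 → ZMod 24) i) =
        ((unitResidues 24).filter fun t => ∀ c ∈ unitResidues 24,
          (c * t ∈ (Finset.univ.image fun i : Fin 4 =>
              if e i then (![1, 5, 7, 11] : Fin 4 → ZMod 24) i else -(![1, 5, 7, 11] : Fin 4 → ZMod 24) i) ↔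
            c ∈ (Finset.univ.image fun i : Fin 4 =>
              if e i then (![1, 5, 7, 11] : Fin 4 → ZMod 24) i else -(![1, 5, 7, 11] : Fin 4 → ZMod 24) i))).image
          fun x => -x := by
  decide

/-- **`|W| = 4` ⟹ `S = W` or `S = −W`**: the eight CM residue sets modulo `24` with a stabiliser of order `4` are the four groups and their
negatives (`S = xW` for any `x ∈ S`; the cosets of `W` are `W, −W` and two others exchanged by `−1`). [cite: BauerCosteItzyksonRuelle1997, §3.4] -/
theorem eq_or_eq_neg_of_card_stabilizerResidues_eq_four_twentyFour {S : Finset (ZMod 24)} (hS : IsCMResidueSet 24 S)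
    (h4 : ((unitResidues 24).filter fun t => ∀ c ∈ unitResidues 24, (c * t ∈ S ↔ c ∈ S)).card = 4) :
    S = ((unitResidues 24).filter fun t => ∀ c ∈ unitResidues 24, (c * t ∈ S ↔ c ∈ S)) ∨
      S = ((unitResidues 24).filter fun t => ∀ c ∈ unitResidues 24, (c * t ∈ S ↔ c ∈ S)).image fun x => -x := by
  obtain ⟨e, rfl⟩ := exists_signs_of_isCMResidueSet_twentyFour hS
  exact forall_signs_eq_or_eq_neg_of_card_eq_four_twentyFour e h4

/-- Over pairs of sign vectors: unit translates iff equal stabilisers. [cite: BauerCosteItzyksonRuelle1997, §3.3–3.4] -/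
private theorem forall_signs_exists_translate_iff_twentyFour : ∀ e e' : Fin 4 → Bool,
    (∃ u ∈ unitResidues 24, ∀ c ∈ unitResidues 24,
        (c ∈ (Finset.univ.image fun i : Fin 4 =>
            if e' i then (![1, 5, 7, 11] : Fin 4 → ZMod 24) i else -(![1, 5, 7, 11] : Fin 4 → ZMod 24) i) ↔
          c * u ∈ (Finset.univ.image fun i : Fin 4 =>
            if e i then (![1, 5, 7, 11] : Fin 4 → ZMod 24) i else -(![1, 5, 7, 11] : Fin 4 → ZMod 24) i))) ↔
      ((unitResidues 24).filter fun t => ∀ c ∈ unitResidues 24,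
          (c * t ∈ (Finset.univ.image fun i : Fin 4 =>
              if e i then (![1, 5, 7, 11] : Fin 4 → ZMod 24) i else -(![1, 5, 7, 11] : Fin 4 → ZMod 24) i) ↔
            c ∈ (Finset.univ.image fun i : Fin 4 =>
              if e i then (![1, 5, 7, 11] : Fin 4 → ZMod 24) i else -(![1, 5, 7, 11] : Fin 4 → ZMod 24) i))) =
        ((unitResidues 24).filter fun t => ∀ c ∈ unitResidues 24,
          (c * t ∈ (Finset.univ.image fun i : Fin 4 =>
              if e' i then (![1, 5, 7, 11] : Fin 4 → ZMod 24) i else -(![1, 5, 7, 11] : Fin 4 → ZMod 24) i) ↔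
            c ∈ (Finset.univ.image fun i : Fin 4 =>
              if e' i then (![1, 5, 7, 11] : Fin 4 → ZMod 24) i else -(![1, 5, 7, 11] : Fin 4 → ZMod 24) i))) := by
  decide

/-- **TRANSLATION CLASSES = STABILISERS AT LEVEL `24`.**  Two CM residue sets `S, S'` modulo `24` are unit translates of each other
(`S' = {c | cu ∈ S}` for a unit `u` — «the same CM-type up to a Galois automorphism») iff `W(S) = W(S')`: the sixteen CM types of `ℚ(ζ₂₄)` fall
into FIVE classes, the orbit of `{1,5,11,17}` (`W = {1}`) and the four pairs `±H` (`W = H` a group of order `4`).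
[cite: BauerCosteItzyksonRuelle1997, §3.3 («`L_{r,s,t} ∼ L_{r',s',t'} ⟺ … H_{r,s,t} = H_{xr',xs',xt'}` for some `x`») and §3.4]
[cite: Shimura1998, §8.4 Example (1)] -/
theorem exists_translate_iff_stabilizerResidues_eq_twentyFour {S S' : Finset (ZMod 24)} (hS : IsCMResidueSet 24 S)
    (hS' : IsCMResidueSet 24 S') :
    (∃ u ∈ unitResidues 24, ∀ c ∈ unitResidues 24, (c ∈ S' ↔ c * u ∈ S)) ↔
      ((unitResidues 24).filter fun t => ∀ c ∈ unitResidues 24, (c * t ∈ S ↔ c ∈ S)) =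
        ((unitResidues 24).filter fun t => ∀ c ∈ unitResidues 24, (c * t ∈ S' ↔ c ∈ S')) := by
  obtain ⟨e, rfl⟩ := exists_signs_of_isCMResidueSet_twentyFour hS
  obtain ⟨e', rfl⟩ := exists_signs_of_isCMResidueSet_twentyFour hS'
  exact forall_signs_exists_translate_iff_twentyFour e e'

end Residues

/-! ## §2 `ℚ(ζ₂₄)`: `Φ₂₄(ζ) = 0`, the square roots of `−6, −1, −3, −2`, and the four fixed fields of the groups of order `4` -/

section Zeta

variable {L : Type} [Field L] [NumberField L] [IsCyclotomicExtension {24} ℚ L]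

/-- `ζ²⁴ = 1`. [cite: Washington1997, Ch. 2 (roots of unity)] -/
theorem zetaOf_pow_twentyFour : zetaOf 24 L ^ 24 = 1 := (IsCyclotomicExtension.zeta_spec 24 ℚ L).pow_eq_one

/-- `ζ¹² = −1` (`ζ¹²` is the primitive square root of unity). [cite: Washington1997, Ch. 2 (roots of unity)] -/
theorem zetaOf_pow_twelve_twentyFour : zetaOf 24 L ^ 12 = -1 :=
  ((IsCyclotomicExtension.zeta_spec 24 ℚ L).pow (by norm_num) (show 24 = 12 * 2 by norm_num)).eq_neg_one_of_two_right

/-- **`Φ₂₄(ζ₂₄) = ζ⁸ − ζ⁴ + 1 = 0`** (`x = ζ⁴` has `x³ = −1`, `x ≠ −1` as `ζ⁸ ≠ 1`). [cite: Washington1997, Ch. 2 (cyclotomic polynomials)] -/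
theorem zetaOf_pow_eight_sub_pow_four_add_one_twentyFour : zetaOf 24 L ^ 8 - zetaOf 24 L ^ 4 + 1 = 0 := by
  have hprim : IsPrimitiveRoot (zetaOf 24 L) 24 := IsCyclotomicExtension.zeta_spec 24 ℚ L
  have h8 : zetaOf 24 L ^ 8 ≠ 1 := hprim.pow_ne_one_of_pos_of_lt (by norm_num) (by norm_num)
  have hne : zetaOf 24 L ^ 4 + 1 ≠ 0 := by
    intro h
    apply h8
    have h4 : zetaOf 24 L ^ 4 = -1 := eq_neg_of_add_eq_zero_left h
    rw [show (8 : ℕ) = 4 * 2 from rfl, pow_mul, h4]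
    norm_num
  have hcube : (zetaOf 24 L ^ 4 + 1) * (zetaOf 24 L ^ 8 - zetaOf 24 L ^ 4 + 1) = 0 := by
    linear_combination zetaOf_pow_twelve_twentyFour (L := L)
  exact (mul_eq_zero.1 hcube).resolve_left hne

/-- **`(ζ + ζ⁵ + ζ⁷ + ζ¹¹)² = −6`**: the Gauss period of the group `{1,5,7,11}` is a square root of `−6` in `ℚ(ζ₂₄)`
(`ζ + ζ¹¹ = 2i sin 15°`, `ζ⁵ + ζ⁷ = 2i sin 75°`; here from `ζ¹² = −1` and `Φ₂₄(ζ) = 0`). [cite: Washington1997, Ch. 2]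
[cite: BauerCosteItzyksonRuelle1997, §3.4] -/
theorem sq_gaussPeriod_twentyFour : (zetaOf 24 L + zetaOf 24 L ^ 5 + zetaOf 24 L ^ 7 + zetaOf 24 L ^ 11) ^ 2 = -6 := by
  linear_combination (zetaOf 24 L ^ 10 + zetaOf 24 L ^ 2 + 2 * zetaOf 24 L ^ 6 + 2 * zetaOf 24 L ^ 4 + 4) *
    zetaOf_pow_twelve_twentyFour (L := L) + 2 * zetaOf_pow_eight_sub_pow_four_add_one_twentyFour (L := L)

/-- **`(ζ³ + ζ⁹)² = −2`** (`ζ³ = ζ₈`: the sibling's `(ζ₈ + ζ₈³)² = −2` inside `ℚ(ζ₂₄)`). [cite: BauerCosteItzyksonRuelle1997, §3.4] -/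
theorem sq_zetaOf_pow_three_add_pow_nine_twentyFour : (zetaOf 24 L ^ 3 + zetaOf 24 L ^ 9) ^ 2 = -2 := by
  linear_combination (zetaOf 24 L ^ 6 + 2) * zetaOf_pow_twelve_twentyFour (L := L)

/-- **`(ζ⁶)² = −1`** (`ζ⁶ = i`). [cite: BauerCosteItzyksonRuelle1997, §3.4] -/
theorem sq_zetaOf_pow_six_twentyFour : (zetaOf 24 L ^ 6) ^ 2 = -1 := by
  rw [← pow_mul]
  exact zetaOf_pow_twelve_twentyFour

/-- `ω = ζ⁸` satisfies `ω² + ω + 1 = 0`. [cite: BauerCosteItzyksonRuelle1997, §3.4] -/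
theorem omega_relation_twentyFour : (zetaOf 24 L ^ 8) ^ 2 + zetaOf 24 L ^ 8 + 1 = 0 := by
  linear_combination (zetaOf 24 L ^ 4) * zetaOf_pow_twelve_twentyFour (L := L) +
    zetaOf_pow_eight_sub_pow_four_add_one_twentyFour (L := L)

/-- **`(1 + 2ζ⁸)² = −3`** (`1 + 2ω = √−3`). [cite: BauerCosteItzyksonRuelle1997, §3.4] -/
theorem sq_one_add_two_zetaOf_pow_eight_twentyFour : (1 + 2 * zetaOf 24 L ^ 8) ^ 2 = -3 := by
  linear_combination (4 * zetaOf 24 L ^ 4) * zetaOf_pow_twelve_twentyFour (L := L) +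
    4 * zetaOf_pow_eight_sub_pow_four_add_one_twentyFour (L := L)

/-- Reduction of exponents modulo `24`. [folklore] -/
private theorem zetaOf_pow_add_mul_twentyFour (q r : ℕ) : zetaOf 24 L ^ (24 * q + r) = zetaOf 24 L ^ r := by
  rw [pow_add, pow_mul, zetaOf_pow_twentyFour, one_pow, one_mul]

/-- `σ_h` (`ζ ↦ ζ^h`) FIXES the Gauss period `ζ + ζ⁵ + ζ⁷ + ζ¹¹` for `h ∈ {5, 7, 11}` (it permutes the four summands).
[cite: Washington1997, Thm. 2.5] -/
theorem apply_gaussPeriod_twentyFour {σ : L ≃ₐ[ℚ] L}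
    (hσ : autResidue 24 L σ = 5 ∨ autResidue 24 L σ = 7 ∨ autResidue 24 L σ = 11) :
    σ (zetaOf 24 L + zetaOf 24 L ^ 5 + zetaOf 24 L ^ 7 + zetaOf 24 L ^ 11) =
      zetaOf 24 L + zetaOf 24 L ^ 5 + zetaOf 24 L ^ 7 + zetaOf 24 L ^ 11 := by
  have h := autResidue_spec 24 σ
  rw [map_add, map_add, map_add, map_pow, map_pow, map_pow, h, ← pow_mul, ← pow_mul, ← pow_mul]
  rcases hσ with h5 | h7 | h11
  · rw [h5, show (5 : ZMod 24).val = 24 * 0 + 5 from rfl, show (24 * 0 + 5) * 5 = 24 * 1 + 1 from rfl,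
      show (24 * 0 + 5) * 7 = 24 * 1 + 11 from rfl, show (24 * 0 + 5) * 11 = 24 * 2 + 7 from rfl,
      zetaOf_pow_add_mul_twentyFour, zetaOf_pow_add_mul_twentyFour, zetaOf_pow_add_mul_twentyFour,
      zetaOf_pow_add_mul_twentyFour]
    ring
  · rw [h7, show (7 : ZMod 24).val = 24 * 0 + 7 from rfl, show (24 * 0 + 7) * 5 = 24 * 1 + 11 from rfl,
      show (24 * 0 + 7) * 7 = 24 * 2 + 1 from rfl, show (24 * 0 + 7) * 11 = 24 * 3 + 5 from rfl,
      zetaOf_pow_add_mul_twentyFour, zetaOf_pow_add_mul_twentyFour, zetaOf_pow_add_mul_twentyFour,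
      zetaOf_pow_add_mul_twentyFour]
    ring
  · rw [h11, show (11 : ZMod 24).val = 24 * 0 + 11 from rfl, show (24 * 0 + 11) * 5 = 24 * 2 + 7 from rfl,
      show (24 * 0 + 11) * 7 = 24 * 3 + 5 from rfl, show (24 * 0 + 11) * 11 = 24 * 5 + 1 from rfl,
      zetaOf_pow_add_mul_twentyFour, zetaOf_pow_add_mul_twentyFour, zetaOf_pow_add_mul_twentyFour,
      zetaOf_pow_add_mul_twentyFour]
    ring

/-- `σ_h` fixes `ζ⁶ = i` for `h ∈ {5, 13, 17}` (`6h ≡ 6 mod 24`). [cite: Washington1997, Thm. 2.5] -/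
theorem apply_zetaOf_pow_six_twentyFour {σ : L ≃ₐ[ℚ] L}
    (hσ : autResidue 24 L σ = 5 ∨ autResidue 24 L σ = 13 ∨ autResidue 24 L σ = 17) : σ (zetaOf 24 L ^ 6) = zetaOf 24 L ^ 6 := by
  have h := autResidue_spec 24 σ
  rw [map_pow, h, ← pow_mul]
  rcases hσ with h5 | h13 | h17
  · rw [h5, show (5 : ZMod 24).val * 6 = 24 * 1 + 6 from rfl, zetaOf_pow_add_mul_twentyFour]
  · rw [h13, show (13 : ZMod 24).val * 6 = 24 * 3 + 6 from rfl, zetaOf_pow_add_mul_twentyFour]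
  · rw [h17, show (17 : ZMod 24).val * 6 = 24 * 4 + 6 from rfl, zetaOf_pow_add_mul_twentyFour]

/-- `σ_h` fixes `ζ⁸ = ω` for `h ∈ {7, 13, 19}` (`8h ≡ 8 mod 24`). [cite: Washington1997, Thm. 2.5] -/
theorem apply_zetaOf_pow_eight_twentyFour {σ : L ≃ₐ[ℚ] L}
    (hσ : autResidue 24 L σ = 7 ∨ autResidue 24 L σ = 13 ∨ autResidue 24 L σ = 19) : σ (zetaOf 24 L ^ 8) = zetaOf 24 L ^ 8 := by
  have h := autResidue_spec 24 σ
  rw [map_pow, h, ← pow_mul]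
  rcases hσ with h7 | h13 | h19
  · rw [h7, show (7 : ZMod 24).val * 8 = 24 * 2 + 8 from rfl, zetaOf_pow_add_mul_twentyFour]
  · rw [h13, show (13 : ZMod 24).val * 8 = 24 * 4 + 8 from rfl, zetaOf_pow_add_mul_twentyFour]
  · rw [h19, show (19 : ZMod 24).val * 8 = 24 * 6 + 8 from rfl, zetaOf_pow_add_mul_twentyFour]

/-- `σ_h` fixes `ζ³ + ζ⁹ = √−2` for `h ∈ {11, 17, 19}` (`h ≡ 1, 3 mod 8`: it fixes or swaps `ζ³, ζ⁹`). [cite: Washington1997, Thm. 2.5] -/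
theorem apply_zetaOf_pow_three_add_pow_nine_twentyFour {σ : L ≃ₐ[ℚ] L}
    (hσ : autResidue 24 L σ = 11 ∨ autResidue 24 L σ = 17 ∨ autResidue 24 L σ = 19) :
    σ (zetaOf 24 L ^ 3 + zetaOf 24 L ^ 9) = zetaOf 24 L ^ 3 + zetaOf 24 L ^ 9 := by
  have h := autResidue_spec 24 σ
  rw [map_add, map_pow, map_pow, h, ← pow_mul, ← pow_mul]
  rcases hσ with h11 | h17 | h19
  · rw [h11, show (11 : ZMod 24).val * 3 = 24 * 1 + 9 from rfl, show (11 : ZMod 24).val * 9 = 24 * 4 + 3 from rfl,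
      zetaOf_pow_add_mul_twentyFour, zetaOf_pow_add_mul_twentyFour, add_comm]
  · rw [h17, show (17 : ZMod 24).val * 3 = 24 * 2 + 3 from rfl, show (17 : ZMod 24).val * 9 = 24 * 6 + 9 from rfl,
      zetaOf_pow_add_mul_twentyFour, zetaOf_pow_add_mul_twentyFour]
  · rw [h19, show (19 : ZMod 24).val * 3 = 24 * 2 + 9 from rfl, show (19 : ZMod 24).val * 9 = 24 * 7 + 3 from rfl,
      zetaOf_pow_add_mul_twentyFour, zetaOf_pow_add_mul_twentyFour, add_comm]

/-- **`σ₅` MOVES `√−2 = ζ³ + ζ⁹`**: `σ₅(ζ³ + ζ⁹) = ζ¹⁵ + ζ²¹ = −(ζ³ + ζ⁹)` (`5 ≡ 5 mod 8` is not in `{1, 3}`). [cite: Washington1997, Thm. 2.5] -/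
theorem apply_zetaOf_pow_three_add_pow_nine_of_autResidue_eq_five {σ : L ≃ₐ[ℚ] L} (hσ : autResidue 24 L σ = 5) :
    σ (zetaOf 24 L ^ 3 + zetaOf 24 L ^ 9) = -(zetaOf 24 L ^ 3 + zetaOf 24 L ^ 9) := by
  have h := autResidue_spec 24 σ
  rw [map_add, map_pow, map_pow, h, ← pow_mul, ← pow_mul, hσ, show (5 : ZMod 24).val * 3 = 15 from rfl,
    show (5 : ZMod 24).val * 9 = 24 * 1 + 21 from rfl, zetaOf_pow_add_mul_twentyFour]
  linear_combination (zetaOf 24 L ^ 3 + zetaOf 24 L ^ 9) * zetaOf_pow_twelve_twentyFour (L := L)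

/-- `ζ³ + ζ⁹ ≠ 0` (its square is `−2`). [folklore] -/
private theorem zetaOf_pow_three_add_pow_nine_ne_zero : zetaOf 24 L ^ 3 + zetaOf 24 L ^ 9 ≠ 0 := by
  intro h
  have h2 := sq_zetaOf_pow_three_add_pow_nine_twentyFour (L := L)
  rw [h] at h2
  norm_num at h2

/-! ### The field `K₁` of the primitive sub-pair when `|W| = 4`: a quadratic field, one of four -/

/-- **`|W| = 4` ⟹ `[K₁ : ℚ] = 2`** (`[ℚ(ζ₂₄) : K₁] = |W|`, `φ(24) = 8`): the simple factor has complex multiplication by an imaginary QUADRATIC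
field. [cite: KoblitzRohrlich1978, §1 p. 1184] [cite: BauerCosteItzyksonRuelle1997, §3.3] -/
theorem finrank_eq_two_of_card_eq_four_twentyFour (Φ : CMType L) {K₁ : IntermediateField ℚ L} (Φ₁ : CMType K₁)
    (h₁ : inducedCMType (algebraMap K₁ L) Φ₁ = Φ)
    (hp₁ : ∀ s t : K₁ →+* ℂ,
      (∀ τ : ℂ ≃+* ℂ, (τ : ℂ →+* ℂ).comp s ∈ Φ₁.1 ↔ (τ : ℂ →+* ℂ).comp t ∈ Φ₁.1) → s = t)
    (h4 : ((unitResidues 24).filter fun t =>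
        ∀ c ∈ unitResidues 24, (c * t ∈ residueSet 24 Φ ↔ c ∈ residueSet 24 Φ)).card = 4) :
    Module.finrank ℚ K₁ = 2 := by
  have hmul := Module.finrank_mul_finrank ℚ K₁ L
  have hφ : Nat.totient 24 = 8 := by decide
  rw [finrank_eq_card_filter_of_primitive (N := 24) Φ Φ₁ h₁ hp₁, h4, finrank_eq_totient 24 L, hφ] at hmul
  omega

/-- **`W = {1,5,7,11}` ⟹ `K₁ = ℚ(√−6) = ℚ(ζ + ζ⁵ + ζ⁷ + ζ¹¹)`**: for every CM type of `ℚ(ζ₂₄)` with this stabiliser the field of ANY primitive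
sub-pair is the fixed field of `σ₅, σ₇, σ₁₁`, containing the Gauss period `δ`, `δ² = −6`, and equal to `ℚ(δ)`, quadratic.
[cite: KoblitzRohrlich1978, §1 p. 1184] [cite: BauerCosteItzyksonRuelle1997, §3.3–3.4] [cite: Shimura1998, §8.2 Prop. 26] -/
theorem eq_adjoin_gaussPeriod_of_stabilizerResidues_eq (Φ : CMType L) {K₁ : IntermediateField ℚ L} (Φ₁ : CMType K₁)
    (h₁ : inducedCMType (algebraMap K₁ L) Φ₁ = Φ)
    (hp₁ : ∀ s t : K₁ →+* ℂ,
      (∀ τ : ℂ ≃+* ℂ, (τ : ℂ →+* ℂ).comp s ∈ Φ₁.1 ↔ (τ : ℂ →+* ℂ).comp t ∈ Φ₁.1) → s = t)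
    (hW : ((unitResidues 24).filter fun t =>
        ∀ c ∈ unitResidues 24, (c * t ∈ residueSet 24 Φ ↔ c ∈ residueSet 24 Φ)) = {1, 5, 7, 11}) :
    zetaOf 24 L + zetaOf 24 L ^ 5 + zetaOf 24 L ^ 7 + zetaOf 24 L ^ 11 ∈ K₁ ∧
      K₁ = IntermediateField.adjoin ℚ {zetaOf 24 L + zetaOf 24 L ^ 5 + zetaOf 24 L ^ 7 + zetaOf 24 L ^ 11} ∧
      (zetaOf 24 L + zetaOf 24 L ^ 5 + zetaOf 24 L ^ 7 + zetaOf 24 L ^ 11) ^ 2 = -6 ∧ Module.finrank ℚ K₁ = 2 := by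
  have hmem : zetaOf 24 L + zetaOf 24 L ^ 5 + zetaOf 24 L ^ 7 + zetaOf 24 L ^ 11 ∈ K₁ := by
    refine (mem_iff_forall_autResidue_mem_of_primitive (N := 24) Φ Φ₁ h₁ hp₁ _).2 fun γ hγ => ?_
    rw [hW] at hγ
    simp only [Finset.mem_insert, Finset.mem_singleton] at hγ
    rcases hγ with h | h | h | h
    · rw [(autResidue_eq_one_iff (N := 24) γ).1 h, AlgEquiv.one_apply]
    · exact apply_gaussPeriod_twentyFour (Or.inl h)
    · exact apply_gaussPeriod_twentyFour (Or.inr (Or.inl h))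
    · exact apply_gaussPeriod_twentyFour (Or.inr (Or.inr h))
  have hdeg := finrank_eq_two_of_card_eq_four_twentyFour Φ Φ₁ h₁ hp₁ (by rw [hW]; decide)
  exact ⟨hmem, eq_adjoin_of_mem_of_sq_eq_neg hmem (m := 6) (by norm_num) (by rw [sq_gaussPeriod_twentyFour]; norm_num) hdeg,
    sq_gaussPeriod_twentyFour, hdeg⟩

/-- **`W = {1,5,13,17}` ⟹ `K₁ = ℚ(i) = ℚ(ζ⁶)`** (`(ζ⁶)² = −1`), quadratic. [cite: KoblitzRohrlich1978, §1 p. 1184]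
[cite: BauerCosteItzyksonRuelle1997, §3.3–3.4] [cite: Shimura1998, §8.2 Prop. 26] -/
theorem eq_adjoin_zetaOf_pow_six_of_stabilizerResidues_eq (Φ : CMType L) {K₁ : IntermediateField ℚ L} (Φ₁ : CMType K₁)
    (h₁ : inducedCMType (algebraMap K₁ L) Φ₁ = Φ)
    (hp₁ : ∀ s t : K₁ →+* ℂ,
      (∀ τ : ℂ ≃+* ℂ, (τ : ℂ →+* ℂ).comp s ∈ Φ₁.1 ↔ (τ : ℂ →+* ℂ).comp t ∈ Φ₁.1) → s = t)
    (hW : ((unitResidues 24).filter fun t =>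
        ∀ c ∈ unitResidues 24, (c * t ∈ residueSet 24 Φ ↔ c ∈ residueSet 24 Φ)) = {1, 5, 13, 17}) :
    zetaOf 24 L ^ 6 ∈ K₁ ∧ K₁ = IntermediateField.adjoin ℚ {zetaOf 24 L ^ 6} ∧ (zetaOf 24 L ^ 6) ^ 2 = -1 ∧
      Module.finrank ℚ K₁ = 2 := by
  have hmem : zetaOf 24 L ^ 6 ∈ K₁ := by
    refine (mem_iff_forall_autResidue_mem_of_primitive (N := 24) Φ Φ₁ h₁ hp₁ _).2 fun γ hγ => ?_
    rw [hW] at hγ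
    simp only [Finset.mem_insert, Finset.mem_singleton] at hγ
    rcases hγ with h | h | h | h
    · rw [(autResidue_eq_one_iff (N := 24) γ).1 h, AlgEquiv.one_apply]
    · exact apply_zetaOf_pow_six_twentyFour (Or.inl h)
    · exact apply_zetaOf_pow_six_twentyFour (Or.inr (Or.inl h))
    · exact apply_zetaOf_pow_six_twentyFour (Or.inr (Or.inr h))
  have hdeg := finrank_eq_two_of_card_eq_four_twentyFour Φ Φ₁ h₁ hp₁ (by rw [hW]; decide)
  exact ⟨hmem, eq_adjoin_of_mem_of_sq_eq_neg hmem (m := 1) (by norm_num) (by rw [sq_zetaOf_pow_six_twentyFour]; norm_num) hdeg,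
    sq_zetaOf_pow_six_twentyFour, hdeg⟩

/-- **`W = {1,7,13,19}` ⟹ `K₁ = ℚ(√−3) = ℚ(1 + 2ζ⁸) ∋ ζ⁸ = ω`** (`(1 + 2ω)² = −3`), quadratic. [cite: KoblitzRohrlich1978, §1 p. 1184]
[cite: BauerCosteItzyksonRuelle1997, §3.3–3.4] [cite: Shimura1998, §8.2 Prop. 26] -/
theorem eq_adjoin_one_add_two_zetaOf_pow_eight_of_stabilizerResidues_eq (Φ : CMType L) {K₁ : IntermediateField ℚ L}
    (Φ₁ : CMType K₁) (h₁ : inducedCMType (algebraMap K₁ L) Φ₁ = Φ)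
    (hp₁ : ∀ s t : K₁ →+* ℂ,
      (∀ τ : ℂ ≃+* ℂ, (τ : ℂ →+* ℂ).comp s ∈ Φ₁.1 ↔ (τ : ℂ →+* ℂ).comp t ∈ Φ₁.1) → s = t)
    (hW : ((unitResidues 24).filter fun t =>
        ∀ c ∈ unitResidues 24, (c * t ∈ residueSet 24 Φ ↔ c ∈ residueSet 24 Φ)) = {1, 7, 13, 19}) :
    1 + 2 * zetaOf 24 L ^ 8 ∈ K₁ ∧ zetaOf 24 L ^ 8 ∈ K₁ ∧ K₁ = IntermediateField.adjoin ℚ {1 + 2 * zetaOf 24 L ^ 8} ∧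
      (1 + 2 * zetaOf 24 L ^ 8) ^ 2 = -3 ∧ Module.finrank ℚ K₁ = 2 := by
  have hω : zetaOf 24 L ^ 8 ∈ K₁ := by
    refine (mem_iff_forall_autResidue_mem_of_primitive (N := 24) Φ Φ₁ h₁ hp₁ _).2 fun γ hγ => ?_
    rw [hW] at hγ
    simp only [Finset.mem_insert, Finset.mem_singleton] at hγ
    rcases hγ with h | h | h | h
    · rw [(autResidue_eq_one_iff (N := 24) γ).1 h, AlgEquiv.one_apply]
    · exact apply_zetaOf_pow_eight_twentyFour (Or.inl h)
    · exact apply_zetaOf_pow_eight_twentyFour (Or.inr (Or.inl h))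
    · exact apply_zetaOf_pow_eight_twentyFour (Or.inr (Or.inr h))
  have h2 : (2 : L) ∈ K₁ := by exact_mod_cast IntermediateField.natCast_mem K₁ 2
  have hmem : 1 + 2 * zetaOf 24 L ^ 8 ∈ K₁ := add_mem (one_mem K₁) (mul_mem h2 hω)
  have hdeg := finrank_eq_two_of_card_eq_four_twentyFour Φ Φ₁ h₁ hp₁ (by rw [hW]; decide)
  exact ⟨hmem, hω, eq_adjoin_of_mem_of_sq_eq_neg hmem (m := 3) (by norm_num)
    (by rw [sq_one_add_two_zetaOf_pow_eight_twentyFour]; norm_num) hdeg, sq_one_add_two_zetaOf_pow_eight_twentyFour, hdeg⟩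

/-- **`W = {1,11,17,19}` ⟹ `K₁ = ℚ(√−2) = ℚ(ζ³ + ζ⁹)`** (`(ζ³ + ζ⁹)² = −2`), quadratic. [cite: KoblitzRohrlich1978, §1 p. 1184]
[cite: BauerCosteItzyksonRuelle1997, §3.3–3.4] [cite: Shimura1998, §8.2 Prop. 26] -/
theorem eq_adjoin_zetaOf_pow_three_add_pow_nine_of_stabilizerResidues_eq (Φ : CMType L) {K₁ : IntermediateField ℚ L}
    (Φ₁ : CMType K₁) (h₁ : inducedCMType (algebraMap K₁ L) Φ₁ = Φ)
    (hp₁ : ∀ s t : K₁ →+* ℂ,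
      (∀ τ : ℂ ≃+* ℂ, (τ : ℂ →+* ℂ).comp s ∈ Φ₁.1 ↔ (τ : ℂ →+* ℂ).comp t ∈ Φ₁.1) → s = t)
    (hW : ((unitResidues 24).filter fun t =>
        ∀ c ∈ unitResidues 24, (c * t ∈ residueSet 24 Φ ↔ c ∈ residueSet 24 Φ)) = {1, 11, 17, 19}) :
    zetaOf 24 L ^ 3 + zetaOf 24 L ^ 9 ∈ K₁ ∧ K₁ = IntermediateField.adjoin ℚ {zetaOf 24 L ^ 3 + zetaOf 24 L ^ 9} ∧
      (zetaOf 24 L ^ 3 + zetaOf 24 L ^ 9) ^ 2 = -2 ∧ Module.finrank ℚ K₁ = 2 := by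
  have hmem : zetaOf 24 L ^ 3 + zetaOf 24 L ^ 9 ∈ K₁ := by
    refine (mem_iff_forall_autResidue_mem_of_primitive (N := 24) Φ Φ₁ h₁ hp₁ _).2 fun γ hγ => ?_
    rw [hW] at hγ
    simp only [Finset.mem_insert, Finset.mem_singleton] at hγ
    rcases hγ with h | h | h | h
    · rw [(autResidue_eq_one_iff (N := 24) γ).1 h, AlgEquiv.one_apply]
    · exact apply_zetaOf_pow_three_add_pow_nine_twentyFour (Or.inl h)
    · exact apply_zetaOf_pow_three_add_pow_nine_twentyFour (Or.inr (Or.inl h))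
    · exact apply_zetaOf_pow_three_add_pow_nine_twentyFour (Or.inr (Or.inr h))
  have hdeg := finrank_eq_two_of_card_eq_four_twentyFour Φ Φ₁ h₁ hp₁ (by rw [hW]; decide)
  exact ⟨hmem, eq_adjoin_of_mem_of_sq_eq_neg hmem (m := 2) (by norm_num)
    (by rw [sq_zetaOf_pow_three_add_pow_nine_twentyFour]; norm_num) hdeg, sq_zetaOf_pow_three_add_pow_nine_twentyFour, hdeg⟩

/-- **`W = {1,5,7,11}` ⟹ `√−2 = ζ³ + ζ⁹ ∉ K₁`**: the field of the elliptic factor of a type with stabiliser `{1,5,7,11}` is NOT `ℚ(√−2)`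
(`σ₅` fixes `K₁` pointwise but sends `ζ³ + ζ⁹` to its negative). [cite: KoblitzRohrlich1978, §1 p. 1184] [cite: Washington1997, Thm. 2.5] -/
theorem zetaOf_pow_three_add_pow_nine_notMem_of_stabilizerResidues_eq (Φ : CMType L) {K₁ : IntermediateField ℚ L}
    (Φ₁ : CMType K₁) (h₁ : inducedCMType (algebraMap K₁ L) Φ₁ = Φ)
    (hp₁ : ∀ s t : K₁ →+* ℂ,
      (∀ τ : ℂ ≃+* ℂ, (τ : ℂ →+* ℂ).comp s ∈ Φ₁.1 ↔ (τ : ℂ →+* ℂ).comp t ∈ Φ₁.1) → s = t)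
    (hW : ((unitResidues 24).filter fun t =>
        ∀ c ∈ unitResidues 24, (c * t ∈ residueSet 24 Φ ↔ c ∈ residueSet 24 Φ)) = {1, 5, 7, 11}) :
    zetaOf 24 L ^ 3 + zetaOf 24 L ^ 9 ∉ K₁ := by
  intro hmem
  obtain ⟨σ, hσ⟩ := exists_autResidue_eq 24 (L := L) 5 (by decide)
  have h5 : autResidue 24 L σ ∈ ((unitResidues 24).filter fun t =>
      ∀ c ∈ unitResidues 24, (c * t ∈ residueSet 24 Φ ↔ c ∈ residueSet 24 Φ)) := by
    rw [hW, hσ]; decide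
  have hfix := (mem_iff_forall_autResidue_mem_of_primitive (N := 24) Φ Φ₁ h₁ hp₁ _).1 hmem σ h5
  rw [apply_zetaOf_pow_three_add_pow_nine_of_autResidue_eq_five hσ] at hfix
  have h2 : (2 : L) * (zetaOf 24 L ^ 3 + zetaOf 24 L ^ 9) = 0 := by linear_combination -hfix
  rcases mul_eq_zero.1 h2 with h | h
  · norm_num at h
  · exact zetaOf_pow_three_add_pow_nine_ne_zero h

end Zeta

/-! ## §3 On abelian varieties: simple fourfold or `E⁴`; the four fields; five isogeny classes -/

section Varieties

variable {L : Type} [Field L] [NumberField L] [IsCyclotomicExtension {24} ℚ L]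
  {Φ Φ' : CMType L} {A A' : AbelianVariety ℂ} {ι : 𝓞 L →+* End A} {θ : L →+* Module.End ℂ (complexBetti A.X 1)}
  {ι' : 𝓞 L →+* End A'} {θ' : L →+* Module.End ℂ (complexBetti A'.X 1)}

/-- Abelian varieties with complex multiplication by `ℚ(ζ₂₄)` are FOURFOLDS (`φ(24)/2 = 4`). [cite: Shimura1998, §6.2 Thm. 3] -/
theorem dim_eq_four_twentyFour (hA : IsCMTypeRealisation Φ A ι θ) : A.dim = 4 := by
  rw [dim_eq_of_realisation (N := 24) hA]
  decide

/-- **SIMPLE OR `|W| = 4`**: a realisation of a CM type of `ℚ(ζ₂₄)` is simple (`W = {1}`) or has a residue stabiliser of order `4`.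
[cite: BauerCosteItzyksonRuelle1997, §3.4] [cite: KoblitzRohrlich1978, §1 p. 1184] -/
theorem isSimple_or_card_eq_four_twentyFour (hA : IsCMTypeRealisation Φ A ι θ) :
    A.IsSimple ∨ ((unitResidues 24).filter fun t =>
        ∀ c ∈ unitResidues 24, (c * t ∈ residueSet 24 Φ ↔ c ∈ residueSet 24 Φ)).card = 4 := by
  rcases card_stabilizerResidues_eq_one_or_four_twentyFour (isCMResidueSet_residueSet 24 Φ) with h | h
  · exact Or.inl ((isSimple_iff_card_stabilizerResidues_eq_one (N := 24) hA).2 h)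
  · exact Or.inr h

/-- **`|W| = 4`: `A ∼ E × E × E × E` WITH `E` AN ELLIPTIC CURVE** with complex multiplication `𝓞_{K₁} → End E` by the quadratic field `K₁`
of the primitive sub-pair, `𝓞_{K₁}`-equivariantly («isogenous to the product of `|W|` isomorphic simple factors, each one having complex
multiplication by the subfield fixed by `W`»; `2 dim E · 4 = 8`). [cite: BauerCosteItzyksonRuelle1997, §3.3–3.4]
[cite: KoblitzRohrlich1978, §1 p. 1184] [cite: Shimura1998, §8.2 Prop. 26, §6.2 Thm. 3] -/
theorem exists_isIsogeny_pow_four_elliptic_of_card_eq_four_twentyFour (hA : IsCMTypeRealisation Φ A ι θ)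
    (h4 : ((unitResidues 24).filter fun t =>
        ∀ c ∈ unitResidues 24, (c * t ∈ residueSet 24 Φ ↔ c ∈ residueSet 24 Φ)).card = 4) :
    ∃ (K₁ : IntermediateField ℚ L) (Φ₁ : CMType K₁), IsCMField K₁ ∧
      inducedCMType (algebraMap K₁ L) Φ₁ = Φ ∧
      (∀ s t : K₁ →+* ℂ,
        (∀ τ : ℂ ≃+* ℂ, (τ : ℂ →+* ℂ).comp s ∈ Φ₁.1 ↔ (τ : ℂ →+* ℂ).comp t ∈ Φ₁.1) → s = t) ∧
      Module.finrank ℚ K₁ = 2 ∧ A.dim = 4 ∧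
      ∃ (E : AbelianVariety ℂ) (ιE : 𝓞 K₁ →+* End E) (θE : K₁ →+* Module.End ℂ (complexBetti E.X 1)),
        IsCMTypeRealisation Φ₁ E ιE θE ∧ E.dim = 1 ∧
        ∃ (P : AbelianVariety ℂ) (π : Fin 4 → (P ⟶ E)), Nonempty (IsLimit (Fan.mk P π)) ∧
          ∃ g : A ⟶ P, IsIsogeny g ∧
            ∀ j (b : 𝓞 K₁), ι (RingOfIntegers.mapRingHom (algebraMap K₁ L : K₁ →+* L) b) ≫ (g ≫ π j) =
              (g ≫ π j) ≫ ιE b := by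
  haveI : IsCMField L := IsCyclotomicExtension.Rat.isCMField L (S := {24}) ⟨24, rfl, by norm_num⟩
  have H := exists_isIsogeny_power_simple_cyclotomic (N := 24) hA
  rw [h4] at H
  obtain ⟨K₁, Φ₁, hCM, h₁, hp₁, -, E, ιE, θE, hE, -, hdim, P, π, hP, g, hg, hequiv⟩ := H
  have hφ : Nat.totient 24 = 8 := by decide
  rw [hφ] at hdim
  exact ⟨K₁, Φ₁, hCM, h₁, hp₁, finrank_eq_two_of_card_eq_four_twentyFour Φ Φ₁ h₁ hp₁ h4, dim_eq_four_twentyFour hA, E, ιE, θE, hE,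
    by omega, P, π, hP, g, hg, hequiv⟩

/-- **`W = {1,5,7,11}`: `A ∼ E⁴`, `E` ELLIPTIC WITH CM BY `𝓞_{ℚ(√−6)}`**, `K₁ = ℚ(ζ + ζ⁵ + ζ⁷ + ζ¹¹)`, `(ζ + ζ⁵ + ζ⁷ + ζ¹¹)² = −6`.
[cite: BauerCosteItzyksonRuelle1997, §3.3–3.4] [cite: KoblitzRohrlich1978, §1 p. 1184] [cite: Shimura1998, §8.2 Prop. 26, §6.2 Thm. 3] -/
theorem exists_isIsogeny_pow_four_elliptic_sqrt_neg_six (hA : IsCMTypeRealisation Φ A ι θ)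
    (hW : ((unitResidues 24).filter fun t =>
        ∀ c ∈ unitResidues 24, (c * t ∈ residueSet 24 Φ ↔ c ∈ residueSet 24 Φ)) = {1, 5, 7, 11}) :
    ∃ (K₁ : IntermediateField ℚ L) (Φ₁ : CMType K₁), IsCMField K₁ ∧
      zetaOf 24 L + zetaOf 24 L ^ 5 + zetaOf 24 L ^ 7 + zetaOf 24 L ^ 11 ∈ K₁ ∧
      K₁ = IntermediateField.adjoin ℚ {zetaOf 24 L + zetaOf 24 L ^ 5 + zetaOf 24 L ^ 7 + zetaOf 24 L ^ 11} ∧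
      (zetaOf 24 L + zetaOf 24 L ^ 5 + zetaOf 24 L ^ 7 + zetaOf 24 L ^ 11) ^ 2 = -6 ∧ Module.finrank ℚ K₁ = 2 ∧ A.dim = 4 ∧
      inducedCMType (algebraMap K₁ L) Φ₁ = Φ ∧
      ∃ (E : AbelianVariety ℂ) (ιE : 𝓞 K₁ →+* End E) (θE : K₁ →+* Module.End ℂ (complexBetti E.X 1)),
        IsCMTypeRealisation Φ₁ E ιE θE ∧ E.dim = 1 ∧
        ∃ (P : AbelianVariety ℂ) (π : Fin 4 → (P ⟶ E)), Nonempty (IsLimit (Fan.mk P π)) ∧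
          ∃ g : A ⟶ P, IsIsogeny g ∧
            ∀ j (b : 𝓞 K₁), ι (RingOfIntegers.mapRingHom (algebraMap K₁ L : K₁ →+* L) b) ≫ (g ≫ π j) =
              (g ≫ π j) ≫ ιE b := by
  obtain ⟨K₁, Φ₁, hCM, h₁, hp₁, hdeg, hdA, E, ιE, θE, hE, hdE, P, π, hP, g, hg, hequiv⟩ :=
    exists_isIsogeny_pow_four_elliptic_of_card_eq_four_twentyFour hA (by rw [hW]; decide)
  obtain ⟨hmem, hK, hsq, -⟩ := eq_adjoin_gaussPeriod_of_stabilizerResidues_eq Φ Φ₁ h₁ hp₁ hW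
  exact ⟨K₁, Φ₁, hCM, hmem, hK, hsq, hdeg, hdA, h₁, E, ιE, θE, hE, hdE, P, π, hP, g, hg, hequiv⟩

/-- **`W = {1,5,13,17}`: `A ∼ E⁴`, `E` ELLIPTIC WITH CM BY `𝓞_{ℚ(i)}`**, `K₁ = ℚ(ζ⁶)`, `(ζ⁶)² = −1`.
[cite: BauerCosteItzyksonRuelle1997, §3.3–3.4] [cite: KoblitzRohrlich1978, §1 p. 1184] [cite: Shimura1998, §8.2 Prop. 26, §6.2 Thm. 3] -/
theorem exists_isIsogeny_pow_four_elliptic_sqrt_neg_one (hA : IsCMTypeRealisation Φ A ι θ)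
    (hW : ((unitResidues 24).filter fun t =>
        ∀ c ∈ unitResidues 24, (c * t ∈ residueSet 24 Φ ↔ c ∈ residueSet 24 Φ)) = {1, 5, 13, 17}) :
    ∃ (K₁ : IntermediateField ℚ L) (Φ₁ : CMType K₁), IsCMField K₁ ∧
      zetaOf 24 L ^ 6 ∈ K₁ ∧ K₁ = IntermediateField.adjoin ℚ {zetaOf 24 L ^ 6} ∧ (zetaOf 24 L ^ 6) ^ 2 = -1 ∧
      Module.finrank ℚ K₁ = 2 ∧ A.dim = 4 ∧ inducedCMType (algebraMap K₁ L) Φ₁ = Φ ∧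
      ∃ (E : AbelianVariety ℂ) (ιE : 𝓞 K₁ →+* End E) (θE : K₁ →+* Module.End ℂ (complexBetti E.X 1)),
        IsCMTypeRealisation Φ₁ E ιE θE ∧ E.dim = 1 ∧
        ∃ (P : AbelianVariety ℂ) (π : Fin 4 → (P ⟶ E)), Nonempty (IsLimit (Fan.mk P π)) ∧
          ∃ g : A ⟶ P, IsIsogeny g ∧
            ∀ j (b : 𝓞 K₁), ι (RingOfIntegers.mapRingHom (algebraMap K₁ L : K₁ →+* L) b) ≫ (g ≫ π j) =
              (g ≫ π j) ≫ ιE b := by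
  obtain ⟨K₁, Φ₁, hCM, h₁, hp₁, hdeg, hdA, E, ιE, θE, hE, hdE, P, π, hP, g, hg, hequiv⟩ :=
    exists_isIsogeny_pow_four_elliptic_of_card_eq_four_twentyFour hA (by rw [hW]; decide)
  obtain ⟨hmem, hK, hsq, -⟩ := eq_adjoin_zetaOf_pow_six_of_stabilizerResidues_eq Φ Φ₁ h₁ hp₁ hW
  exact ⟨K₁, Φ₁, hCM, hmem, hK, hsq, hdeg, hdA, h₁, E, ιE, θE, hE, hdE, P, π, hP, g, hg, hequiv⟩

/-- **`W = {1,7,13,19}`: `A ∼ E⁴`, `E` ELLIPTIC WITH CM BY `𝓞_{ℚ(√−3)}`**, `K₁ = ℚ(1 + 2ζ⁸) ∋ ζ⁸ = ω`, `(1 + 2ζ⁸)² = −3`.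
[cite: BauerCosteItzyksonRuelle1997, §3.3–3.4] [cite: KoblitzRohrlich1978, §1 p. 1184] [cite: Shimura1998, §8.2 Prop. 26, §6.2 Thm. 3] -/
theorem exists_isIsogeny_pow_four_elliptic_sqrt_neg_three (hA : IsCMTypeRealisation Φ A ι θ)
    (hW : ((unitResidues 24).filter fun t =>
        ∀ c ∈ unitResidues 24, (c * t ∈ residueSet 24 Φ ↔ c ∈ residueSet 24 Φ)) = {1, 7, 13, 19}) :
    ∃ (K₁ : IntermediateField ℚ L) (Φ₁ : CMType K₁), IsCMField K₁ ∧
      1 + 2 * zetaOf 24 L ^ 8 ∈ K₁ ∧ zetaOf 24 L ^ 8 ∈ K₁ ∧ K₁ = IntermediateField.adjoin ℚ {1 + 2 * zetaOf 24 L ^ 8} ∧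
      (1 + 2 * zetaOf 24 L ^ 8) ^ 2 = -3 ∧ Module.finrank ℚ K₁ = 2 ∧ A.dim = 4 ∧ inducedCMType (algebraMap K₁ L) Φ₁ = Φ ∧
      ∃ (E : AbelianVariety ℂ) (ιE : 𝓞 K₁ →+* End E) (θE : K₁ →+* Module.End ℂ (complexBetti E.X 1)),
        IsCMTypeRealisation Φ₁ E ιE θE ∧ E.dim = 1 ∧
        ∃ (P : AbelianVariety ℂ) (π : Fin 4 → (P ⟶ E)), Nonempty (IsLimit (Fan.mk P π)) ∧
          ∃ g : A ⟶ P, IsIsogeny g ∧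
            ∀ j (b : 𝓞 K₁), ι (RingOfIntegers.mapRingHom (algebraMap K₁ L : K₁ →+* L) b) ≫ (g ≫ π j) =
              (g ≫ π j) ≫ ιE b := by
  obtain ⟨K₁, Φ₁, hCM, h₁, hp₁, hdeg, hdA, E, ιE, θE, hE, hdE, P, π, hP, g, hg, hequiv⟩ :=
    exists_isIsogeny_pow_four_elliptic_of_card_eq_four_twentyFour hA (by rw [hW]; decide)
  obtain ⟨hmem, hω, hK, hsq, -⟩ := eq_adjoin_one_add_two_zetaOf_pow_eight_of_stabilizerResidues_eq Φ Φ₁ h₁ hp₁ hW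
  exact ⟨K₁, Φ₁, hCM, hmem, hω, hK, hsq, hdeg, hdA, h₁, E, ιE, θE, hE, hdE, P, π, hP, g, hg, hequiv⟩

/-- **`W = {1,11,17,19}`: `A ∼ E⁴`, `E` ELLIPTIC WITH CM BY `𝓞_{ℚ(√−2)}`**, `K₁ = ℚ(ζ³ + ζ⁹)`, `(ζ³ + ζ⁹)² = −2`.
[cite: BauerCosteItzyksonRuelle1997, §3.3–3.4] [cite: KoblitzRohrlich1978, §1 p. 1184] [cite: Shimura1998, §8.2 Prop. 26, §6.2 Thm. 3] -/
theorem exists_isIsogeny_pow_four_elliptic_sqrt_neg_two (hA : IsCMTypeRealisation Φ A ι θ)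
    (hW : ((unitResidues 24).filter fun t =>
        ∀ c ∈ unitResidues 24, (c * t ∈ residueSet 24 Φ ↔ c ∈ residueSet 24 Φ)) = {1, 11, 17, 19}) :
    ∃ (K₁ : IntermediateField ℚ L) (Φ₁ : CMType K₁), IsCMField K₁ ∧
      zetaOf 24 L ^ 3 + zetaOf 24 L ^ 9 ∈ K₁ ∧ K₁ = IntermediateField.adjoin ℚ {zetaOf 24 L ^ 3 + zetaOf 24 L ^ 9} ∧
      (zetaOf 24 L ^ 3 + zetaOf 24 L ^ 9) ^ 2 = -2 ∧ Module.finrank ℚ K₁ = 2 ∧ A.dim = 4 ∧ inducedCMType (algebraMap K₁ L) Φ₁ = Φ ∧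
      ∃ (E : AbelianVariety ℂ) (ιE : 𝓞 K₁ →+* End E) (θE : K₁ →+* Module.End ℂ (complexBetti E.X 1)),
        IsCMTypeRealisation Φ₁ E ιE θE ∧ E.dim = 1 ∧
        ∃ (P : AbelianVariety ℂ) (π : Fin 4 → (P ⟶ E)), Nonempty (IsLimit (Fan.mk P π)) ∧
          ∃ g : A ⟶ P, IsIsogeny g ∧
            ∀ j (b : 𝓞 K₁), ι (RingOfIntegers.mapRingHom (algebraMap K₁ L : K₁ →+* L) b) ≫ (g ≫ π j) =
              (g ≫ π j) ≫ ιE b := by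
  obtain ⟨K₁, Φ₁, hCM, h₁, hp₁, hdeg, hdA, E, ιE, θE, hE, hdE, P, π, hP, g, hg, hequiv⟩ :=
    exists_isIsogeny_pow_four_elliptic_of_card_eq_four_twentyFour hA (by rw [hW]; decide)
  obtain ⟨hmem, hK, hsq, -⟩ := eq_adjoin_zetaOf_pow_three_add_pow_nine_of_stabilizerResidues_eq Φ Φ₁ h₁ hp₁ hW
  exact ⟨K₁, Φ₁, hCM, hmem, hK, hsq, hdeg, hdA, h₁, E, ιE, θE, hE, hdE, P, π, hP, g, hg, hequiv⟩

/-- **THE DICHOTOMY AT LEVEL `24`.**  Every abelian variety with complex multiplication by `ℚ(ζ₂₄)` is EITHER a SIMPLE FOURFOLD OR isogenous to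
`E × E × E × E` with `E` an elliptic curve with complex multiplication by `𝓞_{ℚ(δ)}`, `ℚ(δ) ⊂ ℚ(ζ₂₄)` quadratic with
`δ² ∈ {−6, −1, −3, −2}` (`δ = ζ+ζ⁵+ζ⁷+ζ¹¹, ζ⁶, 1+2ζ⁸, ζ³+ζ⁹` according to `W`) — BCIR's «`[ℂ⁴/L_{1,3,20}]` … `⊕` … elliptic curves» for
every CM type, not only the Fermat ones. [cite: BauerCosteItzyksonRuelle1997, §3.4] [cite: KoblitzRohrlich1978, §1 p. 1184]
[cite: Shimura1998, §8.2 Prop. 26, §6.2 Thm. 3] -/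
theorem isSimple_or_exists_isIsogeny_pow_four_elliptic_twentyFour (hA : IsCMTypeRealisation Φ A ι θ) :
    A.dim = 4 ∧ (A.IsSimple ∨
      ∃ (K₁ : IntermediateField ℚ L) (Φ₁ : CMType K₁) (δ : L), IsCMField K₁ ∧ δ ∈ K₁ ∧
        K₁ = IntermediateField.adjoin ℚ {δ} ∧ (δ ^ 2 = -6 ∨ δ ^ 2 = -1 ∨ δ ^ 2 = -3 ∨ δ ^ 2 = -2) ∧ Module.finrank ℚ K₁ = 2 ∧
        inducedCMType (algebraMap K₁ L) Φ₁ = Φ ∧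
        ∃ (E : AbelianVariety ℂ) (ιE : 𝓞 K₁ →+* End E) (θE : K₁ →+* Module.End ℂ (complexBetti E.X 1)),
          IsCMTypeRealisation Φ₁ E ιE θE ∧ E.dim = 1 ∧
          ∃ (P : AbelianVariety ℂ) (π : Fin 4 → (P ⟶ E)), Nonempty (IsLimit (Fan.mk P π)) ∧ ∃ g : A ⟶ P, IsIsogeny g) := by
  refine ⟨dim_eq_four_twentyFour hA, ?_⟩
  rcases stabilizerResidues_eq_or_twentyFour (isCMResidueSet_residueSet 24 Φ) with hW | hW | hW | hW | hW
  · exact Or.inl ((isSimple_iff_stabilizerResidues_eq_singleton (N := 24) hA).2 hW)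
  · obtain ⟨K₁, Φ₁, hCM, hmem, hK, hsq, hdeg, -, h₁, E, ιE, θE, hE, hdE, P, π, hP, g, hg, -⟩ :=
      exists_isIsogeny_pow_four_elliptic_sqrt_neg_six hA hW
    exact Or.inr ⟨K₁, Φ₁, _, hCM, hmem, hK, Or.inl hsq, hdeg, h₁, E, ιE, θE, hE, hdE, P, π, hP, g, hg⟩
  · obtain ⟨K₁, Φ₁, hCM, hmem, hK, hsq, hdeg, -, h₁, E, ιE, θE, hE, hdE, P, π, hP, g, hg, -⟩ :=
      exists_isIsogeny_pow_four_elliptic_sqrt_neg_one hA hW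
    exact Or.inr ⟨K₁, Φ₁, _, hCM, hmem, hK, Or.inr (Or.inl hsq), hdeg, h₁, E, ιE, θE, hE, hdE, P, π, hP, g, hg⟩
  · obtain ⟨K₁, Φ₁, hCM, hmem, -, hK, hsq, hdeg, -, h₁, E, ιE, θE, hE, hdE, P, π, hP, g, hg, -⟩ :=
      exists_isIsogeny_pow_four_elliptic_sqrt_neg_three hA hW
    exact Or.inr ⟨K₁, Φ₁, _, hCM, hmem, hK, Or.inr (Or.inr (Or.inl hsq)), hdeg, h₁, E, ιE, θE, hE, hdE, P, π, hP, g, hg⟩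
  · obtain ⟨K₁, Φ₁, hCM, hmem, hK, hsq, hdeg, -, h₁, E, ιE, θE, hE, hdE, P, π, hP, g, hg, -⟩ :=
      exists_isIsogeny_pow_four_elliptic_sqrt_neg_two hA hW
    exact Or.inr ⟨K₁, Φ₁, _, hCM, hmem, hK, Or.inr (Or.inr (Or.inr hsq)), hdeg, h₁, E, ιE, θE, hE, hdE, P, π, hP, g, hg⟩

/-- **THE ISOGENY CLASSES AT LEVEL `24`: `A ∼ A'` ⟺ `W = W'`.**  Two abelian varieties with complex multiplication by `ℚ(ζ₂₄)` (realisations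
of CM types `Φ, Φ'`) are isogenous iff their types have the SAME residue stabiliser: the isogeny classes of abelian varieties with complex
multiplication by `ℚ(ζ₂₄)` are FIVE — the simple fourfolds (`W = {1}`) and the four classes `E⁴` labelled by the quadratic field of `E`
(`A ∼ A'` iff the types are Galois transforms of each other, gen 14, iff `S_{Φ'}` is a unit translate of `S_Φ`, iff `W = W'` by §1).
[cite: BauerCosteItzyksonRuelle1997, §3.3 («isogenous if and only if they have the same CM-type up to a Galois automorphism») and §3.4]
[cite: KoblitzRohrlich1978, §1 p. 1184] [cite: Shimura1998, §8.4 Example (1)] -/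
theorem isIsogenous_iff_stabilizerResidues_eq_twentyFour (hA : IsCMTypeRealisation Φ A ι θ) (hA' : IsCMTypeRealisation Φ' A' ι' θ') :
    IsIsogenous A A' ↔
      ((unitResidues 24).filter fun t => ∀ c ∈ unitResidues 24, (c * t ∈ residueSet 24 Φ ↔ c ∈ residueSet 24 Φ)) =
        ((unitResidues 24).filter fun t => ∀ c ∈ unitResidues 24, (c * t ∈ residueSet 24 Φ' ↔ c ∈ residueSet 24 Φ')) := by
  haveI : IsCMField L := IsCyclotomicExtension.Rat.isCMField L (S := {24}) ⟨24, rfl, by norm_num⟩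
  rw [isIsogenous_iff_exists_unit_translate (N := 24) hA hA',
    exists_translate_iff_stabilizerResidues_eq_twentyFour (isCMResidueSet_residueSet 24 Φ) (isCMResidueSet_residueSet 24 Φ')]

/-- **«THE CORRESPONDING `L_{r,s,t}` ARE ALL EQUAL»: ANY TWO SIMPLE ABELIAN VARIETIES WITH COMPLEX MULTIPLICATION BY `ℚ(ζ₂₄)` ARE ISOGENOUS**
— there is exactly ONE isogeny class of simple abelian fourfolds with complex multiplication by a CM type of `ℚ(ζ₂₄)`, the class of the
realisations of `Φ_{H_{1,3,20}}` («`[ℂ⁴/L_{1,3,20}]^{24}`»). [cite: BauerCosteItzyksonRuelle1997, §3.4] [cite: Shimura1998, §8.4 Example (1)] -/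
theorem isIsogenous_of_isSimple_twentyFour (hA : IsCMTypeRealisation Φ A ι θ) (hA' : IsCMTypeRealisation Φ' A' ι' θ')
    (hs : A.IsSimple) (hs' : A'.IsSimple) : IsIsogenous A A' := by
  rw [isIsogenous_iff_stabilizerResidues_eq_twentyFour hA hA', (isSimple_iff_stabilizerResidues_eq_singleton (N := 24) hA).1 hs,
    (isSimple_iff_stabilizerResidues_eq_singleton (N := 24) hA').1 hs']

/-- And a simple one is never isogenous to a non-simple one (`{1} ≠ W'` of order `4`). [cite: BauerCosteItzyksonRuelle1997, §3.4] -/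
theorem not_isIsogenous_of_isSimple_of_not_isSimple_twentyFour (hA : IsCMTypeRealisation Φ A ι θ)
    (hA' : IsCMTypeRealisation Φ' A' ι' θ') (hs : A.IsSimple) (hs' : ¬A'.IsSimple) : ¬IsIsogenous A A' := by
  rw [isIsogenous_iff_stabilizerResidues_eq_twentyFour hA hA', (isSimple_iff_stabilizerResidues_eq_singleton (N := 24) hA).1 hs]
  intro h
  exact hs' ((isSimple_iff_stabilizerResidues_eq_singleton (N := 24) hA').2 h.symm)

end Varieties

end Literature.AlgebraicGeometry.ComplexMultiplication
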